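import Mathlib
import Summits.ResolutionOfSingularities.ResolutionOfSingularities.Theorems.WeightedInvariantLocalWeightedDropWildPurePowerDescentNormal
import Summits.ResolutionOfSingularities.ResolutionOfSingularities.Theorems.WeightedInvariantLocalWeightedDropWildPurePowerFlagEmbed
import Summits.ResolutionOfSingularities.ResolutionOfSingularities.Theorems.WeightedInvariantLocalWeightedDropWildPurePowerFlagStatements

/-!
# `WeightedInvariant.LocalWeightedDrop`, line `hasse-ridge-face-selection`, piece S3πM: ASSEMBLY — the descent datum of the normalised
# lift from Hauser–Perlega's Propositions 3 and 4 stated on the flag invariant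

Crux item stmt-ResolutionOfSingularities-8899 `LocalWeightedDrop` (route `ResolutionOfSingularities/WeightedInvariant`), serving the
door `WeightedConstruction` stmt-ResolutionOfSingularities-0571.  [OURS · L1 W4.3, chain w43, stub worker 1 (gen 3).  Not a statement
of any manuscript.]

`descent_of_statements`: for `k` algebraically closed of characteristic `p`, `q = p^e`, the descent datum of
`WildPurePower.purePower_won_of_descent₃` — states `(A, E)` (coefficient and exceptional letters), `germ (A, E) = A`, measure
`PurePowerFlag.measure q A E` — satisfies the cover and step properties AS SOON AS `AttainStatement p e k` ([Hauser–Perlega, PRIMS 60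
(2024), Prop. 3]) and `DropStatement p e k` ([loc. cit., Prop. 4]) hold (`…WildPurePowerFlagStatements`).  The strategy: clean; if terminal
up to a triangular change, play that change and exit; otherwise blow up the point and, at an exceptional point `c`, choose slot `1` iff
`c₀ = 0` or (`c₁ ≠ 0` and `E = {y}`), reading the successor on the letter swap (`measure_swap`).  `measure_succ_lt`: the measure
drops along every normalised successor (attainment at the child, domination from the parent, strict monotonicity of `embed`).
`wildPurelyInseparableReductionWon_of_statements`: S3πM VERBATIM from the two statements for all `p`, `k`, `e`.
-/

set_option linter.dupNamespace false -- mandated namespace of this single-conjunct summit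

namespace Summit.ResolutionOfSingularities.ResolutionOfSingularities.Theorems

open Literature.AlgebraicGeometry.Resolution
open Literature.AlgebraicGeometry.Resolution.HauserPerlega2024

namespace PurePowerFlag

open MvPowerSeries

variable {k : Type} [Field k]

/-! ### Suprema of flag ordinals -/

/-- At a state whose flag triples have a greatest element with finite `s`, the supremum of the flag ordinals is attained there. -/
theorem iSup_embed_eq {q : ℕ} {B : MvPowerSeries (Fin 2) k} {E : Finset (Fin 2)} {v : Triple}
    (hv : IsFlagTriple q B E v) (hmax : ∀ w, IsFlagTriple q B E w → w ≤ v) :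
    (⨆ w : {w : Triple // IsFlagTriple q B E w}, embed w.1) = embed v := by
  apply le_antisymm
  · exact ciSup_le' fun w => embed_le_embed (hmax w.1 w.2)
  · exact le_ciSup (Ordinal.bddAbove_of_small) (⟨v, hv⟩ : {w : Triple // IsFlagTriple q B E w})

/-- Every flag ordinal is below the supremum. -/
theorem embed_le_iSup {q : ℕ} {B : MvPowerSeries (Fin 2) k} {E : Finset (Fin 2)} {v : Triple} (hv : IsFlagTriple q B E v) :
    embed v ≤ ⨆ w : {w : Triple // IsFlagTriple q B E w}, embed w.1 :=
  le_ciSup (Ordinal.bddAbove_of_small) (⟨v, hv⟩ : {w : Triple // IsFlagTriple q B E w})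

/-! ### The descent datum from the two statements -/

/-- THE MEASURE DROPS along a normalised successor, given the two statements: parent state `(A, E)` read in orientation `o`
(`B = orient o (cleanSeries q A)`, boundary `orientE o E`), successor `x^q·T = B(x, x(t+y))`, new state `(T + φ'^q, succE t (orientE o E))`. -/
theorem measure_succ_lt (p : ℕ) [Fact p.Prime] [CharP k p] [PerfectRing k p] (e : ℕ)
    (hP3 : AttainStatement p e k) (hP4 : DropStatement p e k)
    (A : MvPowerSeries (Fin 2) k) (E : Finset (Fin 2)) (o : Bool) (t : k) (T φ' : MvPowerSeries (Fin 2) k)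
    (hA0 : constantCoeff A = 0) (hAord : ((p ^ e : ℕ) : ℕ∞) < A.order)
    (hnq : ∀ χ : MvPowerSeries (Fin 2) k, constantCoeff χ = 0 → A ≠ χ ^ (p ^ e))
    (hnT : ¬ TermSub (p ^ e) (cleanSeries (p ^ e) A))
    (hE : t ≠ 0 → (1 : Fin 2) ∈ orientE o E → (0 : Fin 2) ∈ orientE o E)
    (hT : X 0 ^ (p ^ e) * T = subst (PlaneGerm.dirChart t) (orient o (cleanSeries (p ^ e) A)))
    (hpos : ((p ^ e : ℕ) : ℕ∞) < (T + φ' ^ (p ^ e)).order)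
    (hnqT : ∀ χ : MvPowerSeries (Fin 2) k, constantCoeff χ = 0 → T + φ' ^ (p ^ e) ≠ χ ^ (p ^ e)) :
    measure (p ^ e) (T + φ' ^ (p ^ e)) (succE t (orientE o E)) < measure (p ^ e) A E := by
  set q := p ^ e with hq
  set B := cleanSeries q A with hB
  -- the parent, read in orientation `o`
  have hBo_clean : cleanSeries q (orient o B) = orient o B := by
    cases o
    · rw [orient_false, hB, cleanSeries_cleanSeries]
    · rw [orient_true, cleanSeries_swap, hB, cleanSeries_cleanSeries]
  have hBne : B ≠ 0 := cleanSeries_ne_zero p e A hA0 hnq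
  have hBone : orient o B ≠ 0 := by
    cases o
    · exact hBne
    · rw [orient_true]
      intro h0
      apply hBne
      rw [← swap_swap B, h0]
      unfold swap
      exact map_zero _
  have hBord : ((q : ℕ) : ℕ∞) < B.order := lt_of_lt_of_le hAord (order_le_order_cleanSeries q A)
  have hBoord : ((q : ℕ) : ℕ∞) < (orient o B).order := by
    cases o
    · exact hBord
    · rw [orient_true]
      refine lt_of_lt_of_le hBord ?_
      unfold swap
      rw [rename_eq_subst]
      exact order_le_order_subst _ (fun i => by rw [Function.comp_apply, constantCoeff_X]) B
  have hnTo : ¬ TermSub q (orient o B) := by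
    cases o
    · exact hnT
    · rw [orient_true, termSub_swap]; exact hnT
  -- the child
  have hclean : cleanSeries q (T + φ' ^ q) = cleanSeries q T := cleanSeries_add_pow p e T φ'
  have hTord : ((q : ℕ) : ℕ∞) < (cleanSeries q T).order :=
    lt_of_lt_of_le hpos (by rw [← hclean]; exact order_le_order_cleanSeries q _)
  have hμA : measure q A E = Order.succ (⨆ v : {v : Triple // IsFlagTriple q B E v}, embed v.1) :=
    measure_of_not_termSub E hnT
  by_cases hTterm : TermSub q (cleanSeries q T)
  · rw [measure_of_termSub _ (by rw [hclean]; exact hTterm), hμA]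
    exact Order.lt_succ_of_le zero_le
  · rw [measure_of_not_termSub _ (by rw [hclean]; exact hTterm), hμA, Order.succ_lt_succ_iff, hclean]
    -- attainment at the child, domination from the parent
    have hT0 : constantCoeff (T + φ' ^ q) = 0 := by
      rw [← coeff_zero_eq_constantCoeff_apply]
      exact coeff_of_lt_order (lt_of_le_of_lt (by simp) hpos)
    have hTne : cleanSeries q T ≠ 0 := by rw [← hclean]; exact cleanSeries_ne_zero p e _ hT0 hnqT
    obtain ⟨w, hw, hws, hwmax⟩ := hP3 (cleanSeries q T) (succE t (orientE o E)) (cleanSeries_cleanSeries q T)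
      hTne hTord hTterm
    rw [iSup_embed_eq hw hwmax]
    obtain ⟨v, hv, hwv⟩ := hP4 (orient o B) (orientE o E) t T hBo_clean hBone hBoord hnTo hE hT hTord hTterm w hw
    have hv' : IsFlagTriple q B E v := by
      cases o
      · exact hv
      · rw [orient_true, orientE_true, isFlagTriple_swap] at hv; exact hv
    exact lt_of_lt_of_le (embed_lt_embed hwv hws) (embed_le_iSup hv')

/-- The identity substitution has the identity as linear part. -/
theorem linMat_X_det {n : ℕ} : (FormalCoordChange.linMat (X : Fin n → MvPowerSeries (Fin n) k)).det = 1 := by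
  have h : FormalCoordChange.linMat (X : Fin n → MvPowerSeries (Fin n) k) = 1 := by
    ext i j
    rw [FormalCoordChange.linMat, Matrix.of_apply, coeff_X, Matrix.one_apply]
    by_cases hij : i = j
    · subst hij; simp
    · rw [if_neg (fun hh => hij ((Finsupp.single_left_inj one_ne_zero).mp hh).symm), if_neg hij]
  rw [h, Matrix.det_one]

/-- THE DESCENT DATUM OF THE NORMALISED LIFT FROM THE TWO STATEMENTS (`k` algebraically closed of characteristic `p`, `q = p^e`):
states `(A, E)`, `germ = A`, `μ = measure q A E`; cover by `E = ∅`; step = clean, then the terminal triangular change or the point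
blow-up with the slot rule "chart of the exceptional letter at a translated point when there is exactly one". -/
theorem descent_of_statements (p : ℕ) [Fact p.Prime] (k : Type) [Field k] [CharP k p] [IsAlgClosed k] (e : ℕ)
    (hP3 : AttainStatement p e k) (hP4 : DropStatement p e k) :
    ∃ (S : Type) (germ : S → MvPowerSeries (Fin 2) k) (μ : S → Ordinal.{0}),
      (∀ A₀ : MvPowerSeries (Fin 2) k, ((p ^ e : ℕ) : ℕ∞) < A₀.order →
        (∀ χ : MvPowerSeries (Fin 2) k, constantCoeff χ = 0 → A₀ ≠ χ ^ (p ^ e)) → ∃ s, germ s = A₀) ∧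
      (∀ s : S, ((p ^ e : ℕ) : ℕ∞) < (germ s).order →
        (∀ χ : MvPowerSeries (Fin 2) k, constantCoeff χ = 0 → germ s ≠ χ ^ (p ^ e)) →
        ∃ (θ : Fin 2 → MvPowerSeries (Fin 2) k) (φ : MvPowerSeries (Fin 2) k),
          (∀ i, constantCoeff (θ i) = 0) ∧ IsUnit (FormalCoordChange.linMat θ).det ∧ constantCoeff φ = 0 ∧
          ((p ^ e : ℕ) : ℕ∞) < (subst θ (germ s) + φ ^ (p ^ e)).order ∧
          ((∃ χ : MvPowerSeries (Fin 2) k, constantCoeff χ = 0 ∧ subst θ (germ s) + φ ^ (p ^ e) = χ ^ (p ^ e)) ∨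
            ((∃ (r t : ℕ) (U : MvPowerSeries (Fin 2) k), constantCoeff U ≠ 0 ∧ ¬ (p ^ e ∣ r ∧ p ^ e ∣ t) ∧
                subst θ (germ s) + φ ^ (p ^ e) = X (0 : Fin 2) ^ r * X (1 : Fin 2) ^ t * U) ∨
              (∃ (i : Fin 2) (m : ℕ) (g : MvPowerSeries (Fin 2) k), 0 < m ∧ 0 < g.order ∧ g.order < (p ^ e : ℕ) ∧
                subst θ (germ s) + φ ^ (p ^ e) = X i ^ (p ^ e * m) * g)) ∨
            (∀ (c : Fin 2 → k), (∃ i, c i ≠ 0) →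
              (c 0 ≠ 0 ∧ ∀ T : MvPowerSeries (Fin 2) k,
                X 0 ^ (p ^ e) * T = subst (PlaneGerm.dirChart (c 1 / c 0)) (subst θ (germ s) + φ ^ (p ^ e)) →
                ∀ φ' : MvPowerSeries (Fin 2) k, constantCoeff φ' = 0 →
                ((p ^ e : ℕ) : ℕ∞) < (T + φ' ^ (p ^ e)).order →
                (∀ χ : MvPowerSeries (Fin 2) k, constantCoeff χ = 0 → T + φ' ^ (p ^ e) ≠ χ ^ (p ^ e)) →
                ∃ s' : S, germ s' = T + φ' ^ (p ^ e) ∧ μ s' < μ s) ∨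
              (c 1 ≠ 0 ∧ ∀ T : MvPowerSeries (Fin 2) k,
                X 0 ^ (p ^ e) * T = subst (PlaneGerm.dirChart (c 0 / c 1))
                  (rename (Equiv.swap (0 : Fin 2) 1) (subst θ (germ s) + φ ^ (p ^ e))) →
                ∀ φ' : MvPowerSeries (Fin 2) k, constantCoeff φ' = 0 →
                ((p ^ e : ℕ) : ℕ∞) < (T + φ' ^ (p ^ e)).order →
                (∀ χ : MvPowerSeries (Fin 2) k, constantCoeff χ = 0 → T + φ' ^ (p ^ e) ≠ χ ^ (p ^ e)) →
                ∃ s' : S, germ s' = T + φ' ^ (p ^ e) ∧ μ s' < μ s)))) := by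
  classical
  set q := p ^ e with hq
  refine ⟨MvPowerSeries (Fin 2) k × Finset (Fin 2), Prod.fst, fun s => measure q s.1 s.2,
    fun A₀ _ _ => ⟨(A₀, ∅), rfl⟩, ?_⟩
  rintro ⟨A, E⟩ hpos hnq
  simp only at hpos hnq ⊢
  have hA0 : constantCoeff A = 0 := by
    rw [← coeff_zero_eq_constantCoeff_apply]
    exact coeff_of_lt_order (lt_of_le_of_lt (by simp) hpos)
  by_cases hT : TermSub q (cleanSeries q A)
  · -- terminal up to a triangular change: play it and exit
    obtain ⟨o, h, h0, hshape⟩ := hT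
    obtain ⟨θ, hθ0, hθdet, hexp⟩ := expansion_orient_eq p e o h h0 A
    have hθA0 : constantCoeff (subst θ A) = 0 := by
      rw [← coeff_zero_eq_constantCoeff_apply]
      exact coeff_of_lt_order (lt_of_le_of_lt (by simp) (lt_of_lt_of_le hpos (order_le_order_subst θ hθ0 A)))
    obtain ⟨φ, hφ0, hφ⟩ := exists_add_pow_eq_cleanSeries p e (subst θ A) hθA0
    refine ⟨θ, φ, hθ0, hθdet, hφ0, ?_, Or.inr (Or.inl ?_)⟩
    · rw [hφ]
      exact lt_of_lt_of_le hpos (le_trans (order_le_order_subst θ hθ0 A) (order_le_order_cleanSeries q _))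
    · rw [hφ, ← hexp]
      exact hshape
  · -- blow up the point
    obtain ⟨φ, hφ0, hφ⟩ := exists_add_pow_eq_cleanSeries p e A hA0
    have hXA : subst (X : Fin 2 → MvPowerSeries (Fin 2) k) A = A := congrFun subst_self A
    refine ⟨X, φ, fun i => constantCoeff_X i, by rw [linMat_X_det]; exact isUnit_one, hφ0, ?_, Or.inr (Or.inr ?_)⟩
    · rw [hXA, hφ]
      exact lt_of_lt_of_le hpos (order_le_order_cleanSeries q _)
    · intro c hc
      rw [hXA, hφ]
      by_cases hslot : c 0 = 0 ∨ (c 1 ≠ 0 ∧ (1 : Fin 2) ∈ E ∧ (0 : Fin 2) ∉ E)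
      · -- slot `1`, read on the letter swap
        have hc1 : c 1 ≠ 0 := by
          rcases hslot with h0 | ⟨h1, -⟩
          · obtain ⟨i, hi⟩ := hc
            fin_cases i
            · exact absurd h0 hi
            · exact hi
          · exact h1
        refine Or.inr ⟨hc1, fun T hTT φ' hφ'0 hpos' hnq' => ⟨(T + φ' ^ q, succE (c 0 / c 1) (orientE true E)), rfl, ?_⟩⟩
        refine measure_succ_lt p e hP3 hP4 A E true (c 0 / c 1) T φ' hA0 hpos hnq hT ?_ ?_ hpos' hnq'
        · intro ht h1
          rw [orientE_true, mem_swapE, Equiv.swap_apply_right] at h1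
          rw [orientE_true, mem_swapE, Equiv.swap_apply_left]
          rcases hslot with h0 | ⟨-, -, h0E⟩
          · exact absurd (by rw [h0, zero_div]) ht
          · exact absurd h1 h0E
        · rw [orient_true]; exact hTT
      · -- slot `0`
        push Not at hslot
        obtain ⟨hc0, hrest⟩ := hslot
        refine Or.inl ⟨hc0, fun T hTT φ' hφ'0 hpos' hnq' => ⟨(T + φ' ^ q, succE (c 1 / c 0) (orientE false E)), rfl, ?_⟩⟩
        refine measure_succ_lt p e hP3 hP4 A E false (c 1 / c 0) T φ' hA0 hpos hnq hT ?_ ?_ hpos' hnq'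
        · intro ht h1
          rw [orientE_false] at h1 ⊢
          have hc1 : c 1 ≠ 0 := fun h => ht (by rw [h, zero_div])
          exact hrest hc1 h1
        · rw [orient_false]; exact hTT

/-- S3πM `stub_wildPurelyInseparableReductionWon` (skeleton v28) VERBATIM from the two printed statements on the game-side flag
invariant — [HP24, Prop. 3] (attainment) and [HP24, Prop. 4] (drop along normalised point blow-ups) — for every algebraically closed
field of characteristic `p` and every `q = p^e > 2`. -/
theorem wildPurelyInseparableReductionWon_of_statements
    (hP3 : ∀ (p : ℕ), p.Prime → ∀ (k : Type) [Field k] [CharP k p] [IsAlgClosed k] (e : ℕ), 2 < p ^ e → AttainStatement p e k)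
    (hP4 : ∀ (p : ℕ), p.Prime → ∀ (k : Type) [Field k] [CharP k p] [IsAlgClosed k] (e : ℕ), 2 < p ^ e → DropStatement p e k) :
    ∀ (p : ℕ), p.Prime → ∀ (k : Type) [Field k] [CharP k p] [IsAlgClosed k],
      (∀ m : ℕ, m < 3 → ∀ g : MvPowerSeries (Fin m) k,
        CobordantGame.IsSingular k g → CobordantGame.Won k m g) →
      ∀ (d : ℕ), (∃ e : ℕ, d = p ^ e) → 2 < d →
      (∀ g : MvPowerSeries (Fin 3) k, CobordantGame.IsSingular k g → g.order < d →
        CobordantGame.Won k 3 g) →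
      (∀ g : MvPowerSeries (Fin 3) k, CobordantGame.IsSingular k g → g.order = d →
        (∃ c : Fin 3 → k, c ≠ 0 ∧ ∀ v : Fin 3 → k,
          CobordantChart.initEval (fun _ : Fin 3 => 1) (v + c) d g =
            CobordantChart.initEval (fun _ : Fin 3 => 1) v d g) →
        (∀ c₁ c₂ : Fin 3 → k,
          (∀ v : Fin 3 → k, CobordantChart.initEval (fun _ : Fin 3 => 1) (v + c₁) d g =
            CobordantChart.initEval (fun _ : Fin 3 => 1) v d g) →
          (∀ v : Fin 3 → k, CobordantChart.initEval (fun _ : Fin 3 => 1) (v + c₂) d g =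
            CobordantChart.initEval (fun _ : Fin 3 => 1) v d g) →
          ∃ α β : k, (α ≠ 0 ∨ β ≠ 0) ∧ α • c₁ + β • c₂ = 0) →
        CobordantGame.Won k 3 g) →
      (∀ (A₀ : MvPowerSeries (Fin 2) k), (d : ℕ∞) < A₀.order →
        ((∃ (r s : ℕ) (U : MvPowerSeries (Fin 2) k), MvPowerSeries.constantCoeff U ≠ 0 ∧ ¬ (d ∣ r ∧ d ∣ s) ∧
            A₀ = MvPowerSeries.X (0 : Fin 2) ^ r * MvPowerSeries.X (1 : Fin 2) ^ s * U) ∨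
          (∃ (i : Fin 2) (m : ℕ) (g : MvPowerSeries (Fin 2) k), 0 < m ∧ 0 < g.order ∧ g.order < d ∧
            A₀ = MvPowerSeries.X i ^ (d * m) * g)) →
        CobordantGame.Won k 3 (MvPowerSeries.X (Fin.last 2) ^ d +
          MvPowerSeries.rename (Fin.succAboveEmb (Fin.last 2)) A₀)) →
      ∀ (A₀ : MvPowerSeries (Fin 2) k), (d : ℕ∞) < A₀.order →
        CobordantGame.Won k 3 (MvPowerSeries.X (Fin.last 2) ^ d +
          MvPowerSeries.rename (Fin.succAboveEmb (Fin.last 2)) A₀) :=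
  WildPurePower.wildPurelyInseparableReductionWon_of_descent₃ fun p hp k _ _ _ e h2 _ _ _ => by
    haveI := Fact.mk hp
    exact descent_of_statements p k e (hP3 p hp k e h2) (hP4 p hp k e h2)

end PurePowerFlag

end Summit.ResolutionOfSingularities.ResolutionOfSingularities.Theorems
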